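import Summits.BirchSwinnertonDyer.Rank1Residual.Additive.TameBranchRatCharEqDefectTwo
import HarnessLib

/-!
# HEADLINES: `TameBranchRatCharEqAt W p` — cc-typer-2's typed RATIONAL MAIN CONJECTURE — HOLDS at
# every certified pair of X4♯(G-ord) ∩ `I₀*` ∩ {`ρ̄` onto} (`p ≥ 5`), rank 0 (`λ_an = 2`) and rank 1
# (`λ_an = 3`), from Kato 17.4 (3) + Delbourgo 2002 (A)(B) + GZK + Greenberg Prop. 3.10 + finite data
# (cell `b2b-bsdres`, sub-cell additive-p2 = X3♯(G-ord)/X4♯(G-ord), gen 31; part 4b — class level)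

HONEST FRAMING (cell `b2b-bsdres`, run/shared/lean/b2b/bsd-rank1-residual/, verbatim in every
file): the goal of the cell is to DELETE the COMBINATION-SHAPED residual classes of the
Birch–Swinnerton-Dyer formula for ALL analytic-rank `≤ 1` elliptic curves over `ℚ` — "full BSD
formula for every rank `≤ 1` curve in class `C`" assembled STRICTLY from published theorems — so
that the rank-`≤ 1` remainder becomes exactly the CONSTRUCTION-SHAPED classes, which are TYPED
(missing-input `Prop`s), NOT attempted. This is not "finishing BSD". Sub-cell additive-p2: the
classes X3♯(G-ord) / X4♯(G-ord) are CONSTRUCTION-SHAPED and stay so; labels / RESIDUAL-MAP marks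
UNCHANGED; nothing is booked (the main conjecture at a pair is NOT `BSD(E,p)`: at rank 0 these rows'
`BSD(E,p)` was already closed by gen 12 when `p ∤ #Ш_an`, at rank 1 the branch `p`-adic Gross–Zagier is
still owed). Theorems only; every published input is an explicit named-fact binder: `hK` = the
semistable big-image half-eigenspace reading of Kato 2004 Thm. 17.4 (3), `hmodD` = BCDT modular
parametrisations, `hDel` = Delbourgo 2002 (A)+(B) (A175), `hGZK` = Gross–Zagier–Kolyvagin, `hmod` =
modularity, `h310` = Greenberg 1999 Prop. 3.10. No definition, no named fact minted, no `sorry`.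

## What and why

Part 4 (`TameBranchRatCharEqDefectTwo.lean`) turned "`char_Λ X(E/ℚ_∞)` is generated by the Kato-brick
element `g₁`, `ι g₁ = C(u·ϖ)·B^±_{(p−1)/2}(f♭, α)`" into the conclusion of cc-typer-2's
`TameBranchRatCharEqAt W p` for every normalised tuple of the E-normalised package (dictionary +
rigidity + rescaling; one non-zero plus symbol of `E`'s newform excludes the degenerate constant).
Part 2 (`TameBranchMuPartDefectTwo.lean`) supplies, per cyclotomic datum, `char_Λ X = (g₁)` from the
first unit coefficient of `ϖ·B^±` at `rank + 2` (`μ = 0` a theorem), Delbourgo 2002 (B), Greenberg's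
parity and the squeeze witness. THIS FILE assembles the two class-level HEADLINES on
X4♯(G-ord) ∩ `I₀*` ∩ {`ρ̄` onto}, `p ≥ 5`:

* **`ClassX4Gord.tameBranchRatCharEqAt_of_katoHalf_of_firstUnit_two_rankZero`** — `r_an = 0`, `E`
  non-CM: first unit coefficient of `ϖ·B^±` at index `2` with `ϖ·B^±(0) ≠ 0`, and
  `2·ord_p #E(ℚ)_tors < ord_p ∏c_ℓ` ⟹ **`TameBranchRatCharEqAt W p`**, `μ = 0`, `λ = 2` (the (B)-datum
  is A175's; `[0]⁺_{f_E} ≠ 0` from `L(E,1) ≠ 0`);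
* **`ClassX4Gord.tameBranchRatCharEqAt_of_katoHalf_of_firstUnit_three_rankOne`** — `r_an = 1`, a
  (B)-datum `Dh`: first unit coefficient at `3` with `[T¹](ϖ·B^±) ≠ 0`, one non-zero plus symbol of
  `E`'s newform, `1 + 2·ord_p #tors < v + ord_p ∏c_ℓ` with `v ≤ ord_p Reg_p(E,Dh)` ⟹
  **`TameBranchRatCharEqAt W p`**, `μ = 0`, `λ = 3`.

"OUR CONJECTURE, OPEN on every cell" (`TameBranchLower.lean`) is thus a THEOREM, pair by pair, on the
defect-2 big-image rows whose census columns read `(μ_an, λ_an) = (0, rank + 2)` with the Tamagawa /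
regulator witness. What is NOT claimed: `BSD(E,p)`; defect 3, 4, 6; `p = 3`; the certificates (numerical,
per pair). Labels UNCHANGED.

References: Kato 2004 Thm. 17.4 (3) [Kato2004Asterisque]; Delbourgo 2002 Thm. (A), (B) p. 40
[Delbourgo2002]; Greenberg LNM 1716 Prop. 3.10, §5 p. 183 [GreenbergLNM1716]; Mazur–Tate–Teitelbaum
1986 §I.13–I.14 [MazurTateTeitelbaum1986Invent]; Delbourgo 1998 p. 151 [Delbourgo1998];
`X1/ParitySqueeze.lean` (eisenstein-p1, route P at `147b1@13`). -/

set_option autoImplicit false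

noncomputable section

open scoped Classical MatrixGroups ModularForm NumberField

open CongruenceSubgroup IsDedekindDomain WeierstrassCurve NumberField
  Literature.NumberTheory.EllipticCurves
  Literature.NumberTheory.EllipticCurves.ModularForms
  Literature.NumberTheory.EllipticCurves.Rank1Residual
  Literature.NumberTheory.EllipticCurves.Rank1Residual.Typed
  Literature.NumberTheory.EllipticCurves.Delbourgo2002
  Literature.NumberTheory.EllipticCurves.Greenberg1999
  Literature.NumberTheory.GaloisRepresentations
  Summit.BirchSwinnertonDyer.Rank1Residual.AdditivePotMult
  Summit.BirchSwinnertonDyer.Rank1Residual.X1.MuLambda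
  Summit.BirchSwinnertonDyer.Rank1Residual.X1.RankOneParitySqueeze
  Summit.BirchSwinnertonDyer.Rank1Residual.X11a.LambdaNorm

namespace Summit.BirchSwinnertonDyer.Rank1Residual.Additive

/-! ### §3 The two headlines -/

section Headlines

open TameBranchMuPart

variable {W : WeierstrassCurve ℚ} [W.IsElliptic] [W.IsGloballyMinimal] {p : ℕ} [hp : Fact p.Prime]

/-- **HEADLINE, RANK ZERO. `TameBranchRatCharEqAt W p` on X4♯(G-ord) ∩ `I₀*` ∩ {`ρ̄` onto}, `p ≥ 5`,
`E` non-CM, `ord_{s=1} L(E,s) = 0`, from Kato 17.4 (3) + Delbourgo 2002 (A)(B) + GZK + modularity +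
Greenberg Prop. 3.10 + TWO finite data: the first unit coefficient of `ϖ·B^±_{(p−1)/2}(f♭, α)` sits at
index `2` with `B^±(0) ≠ 0` (`(μ_an, λ_an) = (0, 2)`), and the squeeze witness `2·ord_p #E(ℚ)_tors <
ord_p ∏c_ℓ`.** Moreover every generator of `char_Λ X(E/ℚ_∞)` has `μ = 0`, `λ = 2`. The cell's typed
rational main conjecture — "OUR CONJECTURE, OPEN on every cell" — is a THEOREM at these pairs.
[cite: Kato2004Asterisque, Thm. 17.4 (3) (p. 273)] [cite: Delbourgo2002, Theorem (A), (B) (p. 40)]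
[cite: GreenbergLNM1716, Prop. 3.10 and §5 p. 183] [cite: MazurTateTeitelbaum1986Invent, §I.13–I.14] -/
theorem ClassX4Gord.tameBranchRatCharEqAt_of_katoHalf_of_firstUnit_two_rankZero
    (hK : Wuthrich2014.kato_halfEigenCharIdeal_dvd_cyclotomicPrime_of_surjective)
    (hmodD : nonempty_modularParametrizationData) (hDel : Delbourgo2002.mainTheorem)
    (hGZK : rank_eq_analyticRank_of_analyticRank_le_one) (hmod : hasEntireLFunction_rat)
    (h310 : prop310_selmerCorank_mod_two_eq_lambdaInvariant)
    (hX : ClassX4Gord W p) (hp5 : 5 ≤ p) (hcm : ¬ W.HasCM) (he : semistabilityIndex W p = 2)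
    (hsurj : Surj W p) (hr : W.analyticRank = 0)
    (hcert : ∀ (V : WeierstrassCurve ℚ) [V.IsElliptic] [V.IsGloballyMinimal] (C : VariableChange ℚ),
      C • V.quadraticTwist ((-1 : ℚ) ^ (p / 2) * p) = W → IsOrdinaryAt V p →
      ∀ {N : ℕ} [NeZero N] (f : CuspForm (Gamma0 N) 2), IsNewformOf V f →
      ∀ ϖ : ℚ, (if Even (p / 2) then (ϖ : ℝ) * V.realPeriodRat = plusPeriod f
          else (ϖ : ℝ) * V.imaginaryPeriodRat = minusPeriod f) →
        PowerSeries.constantCoeff (PowerSeries.C (ϖ : ℚ_[p]) *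
            (if Even (p / 2) then padicLFunctionBranch f ((unitRoot V p : ℤ_[p]) : ℚ_[p]) (p / 2)
              else padicLFunctionMinusBranch f ((unitRoot V p : ℤ_[p]) : ℚ_[p]) (p / 2))) ≠ 0 ∧
        ‖PowerSeries.coeff 2 (PowerSeries.C (ϖ : ℚ_[p]) *
            (if Even (p / 2) then padicLFunctionBranch f ((unitRoot V p : ℤ_[p]) : ℚ_[p]) (p / 2)
              else padicLFunctionMinusBranch f ((unitRoot V p : ℤ_[p]) : ℚ_[p]) (p / 2)))‖ = 1 ∧
        ∀ i < 2, ‖PowerSeries.coeff i (PowerSeries.C (ϖ : ℚ_[p]) *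
            (if Even (p / 2) then padicLFunctionBranch f ((unitRoot V p : ℤ_[p]) : ℚ_[p]) (p / 2)
              else padicLFunctionMinusBranch f ((unitRoot V p : ℤ_[p]) : ℚ_[p]) (p / 2)))‖ < 1)
    (hb : 2 * padicValNat p W.torsionOrder < padicValNat p W.tamagawaProduct) :
    TameBranchRatCharEqAt W p ∧
      ∀ (κ : ZpExtension ℚ p) (γ : Field.absoluteGaloisGroup ℚ),
        κ.IsCyclotomic → κ.IsTopGenerator γ → IsCyclotomicVariable p γ →
        ∀ (D : W.SelmerDualData κ γ) (fE : IwasawaAlgebra p), D.charIdeal = Ideal.span {fE} →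
          mu fE = 0 ∧ lam fE = 2 := by
  have hp2 : p ≠ 2 := by omega
  have hadd : ¬ W.HasGoodReductionAtPrime p ∧ ¬ W.HasMultiplicativeReductionAtPrime p := hX.addv.2
  obtain ⟨hmw, -⟩ := hGZK W (by rw [hr]; norm_num)
  have hr0 : W.mordellWeilRank = 0 := by rw [hmw, hr]
  have hL : W.entireLFunction 1 ≠ 0 := (W.analyticRank_eq_zero_iff_holds (hmod W)).mp hr
  obtain ⟨Dh, hBcl⟩ := Delbourgo2002.mainTheorem.exists_leadingTermClauses hDel hp5 hcm hadd hX.typeGOrd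
  obtain ⟨V, iV, iVm, C, hV, hC⟩ := hX.exists_goodOrd_pStar_twist_model W p he
  haveI : NeZero (V.conductorNorm ℤ) := ⟨(V.conductorNorm_pos_holds).ne'⟩
  obtain ⟨Dm⟩ := hmodD V
  obtain ⟨ϖ, hϖ⟩ := exists_periodRatio_parity (p := p) V Dm
  have hj := padicValRat_j_nonneg_of_typeGOrd W p hX.typeGOrd
  have hsurjV : ∀ m : ℕ, V.HasSurjectiveModNGaloisRep (p ^ m : ℕ) :=
    X4RankZeroTwistOdd.forall_surj_pow_twist_of_surj W p hp5 V (pStar_ne_zero p) C hC hsurj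
  have hord : IsOrdinaryAt V p :=
    isOrdinaryAt_of_goodOrd_or_mult_of_model_twist W V (pStar_ne_zero p) ⟨C, hC⟩ hj (Or.inl hV)
  obtain ⟨h0, hn, hlt⟩ := hcert V C hC hord Dm.f Dm.isNewformOf ϖ hϖ
  -- the branch and the period ratio are non-zero
  have hϖ0 : ϖ ≠ 0 := by
    rintro rfl
    apply h0
    rw [Rat.cast_zero, map_zero, zero_mul, map_zero]
  have hB0 : (if Even (p / 2) then padicLFunctionBranch Dm.f ((unitRoot V p : ℤ_[p]) : ℚ_[p]) (p / 2)
      else padicLFunctionMinusBranch Dm.f ((unitRoot V p : ℤ_[p]) : ℚ_[p]) (p / 2)) ≠ 0 := by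
    intro e; apply h0; rw [e, mul_zero, map_zero]
  -- per datum: the squeeze of part 2
  have key : ∀ (κ : ZpExtension ℚ p) (γ : Field.absoluteGaloisGroup ℚ),
      κ.IsCyclotomic → κ.IsTopGenerator γ → IsCyclotomicVariable p γ →
      ∀ (D : W.SelmerDualData κ γ) (fE : IwasawaAlgebra p), D.charIdeal = Ideal.span {fE} →
        D.IsTorsion ∧ mu fE = 0 ∧ lam fE = 2 ∧ ∃ (g₁ : IwasawaAlgebra p) (u : ℤ_[p]ˣ),
          D.charIdeal = Ideal.span {g₁} ∧ iwasawaToPowerSeries p g₁ =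
            PowerSeries.C (((u : ℤ_[p]) : ℚ_[p]) * (ϖ : ℚ_[p])) *
              (if Even (p / 2) then padicLFunctionBranch Dm.f ((unitRoot V p : ℤ_[p]) : ℚ_[p]) (p / 2)
                else padicLFunctionMinusBranch Dm.f ((unitRoot V p : ℤ_[p]) : ℚ_[p]) (p / 2)) := by
    intro κ γ hκ hγ hγ' D fE hchar
    haveI : Module.Finite (IwasawaAlgebra p) D.X :=
      SelmerDualData.module_finite_of_isCyclotomic (W := W) (κ := κ) hκ D hγ
    obtain ⟨hXt, g, hg, u, hι⟩ := isTorsion_and_exists_iota_eq_branch_of_katoComponent W p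
      (Kato2004.charIdeal_dvd_padicLFunctionBranch_component_of_surjective_of_half hK) hj hp2 V
      ⟨C, hC⟩ (Or.inl hV) hsurjV hκ hγ hγ' Dm.isNewformOf D ϖ hϖ
    have hn' := hn
    rw [← norm_coeff_C_unit_mul u] at hn'
    have hX0 : PowerSeries.constantCoeff (PowerSeries.C (((u : ℤ_[p]) : ℚ_[p]) * (ϖ : ℚ_[p])) *
        (if Even (p / 2) then padicLFunctionBranch Dm.f ((unitRoot V p : ℤ_[p]) : ℚ_[p]) (p / 2)
          else padicLFunctionMinusBranch Dm.f ((unitRoot V p : ℤ_[p]) : ℚ_[p]) (p / 2))) ≠ 0 := by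
      rw [map_mul, PowerSeries.constantCoeff_C, mul_assoc]
      rw [map_mul, PowerSeries.constantCoeff_C] at h0
      exact mul_ne_zero (PadicInt.coe_ne_zero.mpr u.ne_zero) h0
    obtain ⟨hμ, hlam, hspan⟩ := charIdeal_eq_span_of_iota_eq_of_firstUnit_two_rankZero h310 hp2 hr0
      hBcl hκ hγ hγ' D hXt hchar hg hι hn' (fun i hi ↦ by rw [norm_coeff_C_unit_mul u]; exact hlt i hi)
      hX0 hb
    exact ⟨hXt, hμ, hlam, g, u, hspan, hι⟩
  refine ⟨?_, fun κ γ hκ hγ hγ' D fE hchar ↦ ⟨(key κ γ hκ hγ hγ' D fE hchar).2.1,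
    (key κ γ hκ hγ hγ' D fE hchar).2.2.1⟩⟩
  intro κ γ N _ f ε α B _ haddv _ hκ hγ hcv hf _ hα hB D
  haveI : (Literature.NumberTheory.EllipticCurves.Module.charIdeal (IwasawaAlgebra p) D.X).IsPrincipal :=
    charIdeal_isPrincipal_holds p D.X
  obtain ⟨fE, hchar⟩ := Submodule.IsPrincipal.principal
    (Literature.NumberTheory.EllipticCurves.Module.charIdeal (IwasawaAlgebra p) D.X)
  obtain ⟨hXt, -, -, g₁, u, hspan, hι⟩ := key κ γ hκ hγ hcv D fE hchar
  -- `E`'s plus symbol is not identically zero: `[0]⁺_f ≠ 0` from `L(E,1) ≠ 0`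
  have hnd : ∃ s : ℚ, ratPlusSymbol f s ≠ 0 := by
    refine ⟨0, fun h00 ↦ hL ?_⟩
    rw [hf.entireLFunction_one_eq, h00]
    simp
  exact ⟨hXt, exists_charIdeal_eq_span_and_iota_eq_of_generator hp2 V C hC haddv hV hf hnd Dm hϖ0
    hspan hι hB0 hα hB⟩

/-- **HEADLINE, RANK ONE. `TameBranchRatCharEqAt W p` on X4♯(G-ord) ∩ `I₀*` ∩ {`ρ̄` onto}, `p ≥ 5`,
`ord_{s=1} L(E,s) = 1`, for a (B)-datum `Dh` (in particular Delbourgo's `⟨,⟩_{p,ℚ}`), from Kato 17.4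
(3) + (B) + GZK + Prop. 3.10 + the data: first unit coefficient of `ϖ·B^±` at index `3` with
`[T¹] ≠ 0` (`(μ_an, λ_an) = (0, 3)`, simple zero), a non-zero plus symbol of `E`'s newform, and the
squeeze witness `1 + 2·ord_p #tors < v + ord_p ∏c_ℓ` for a certified `v ≤ ord_p Reg_p(E,Dh)`.**
Moreover every generator has `μ = 0`, `λ = 3`. [cite: Kato2004Asterisque, Thm. 17.4 (3) (p. 273)]
[cite: Delbourgo2002, Theorem (B) (p. 40)] [cite: GreenbergLNM1716, Prop. 3.10 and §5 p. 183]
[cite: MazurTateTeitelbaum1986Invent, §I.13–I.14] -/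
theorem ClassX4Gord.tameBranchRatCharEqAt_of_katoHalf_of_firstUnit_three_rankOne
    (hK : Wuthrich2014.kato_halfEigenCharIdeal_dvd_cyclotomicPrime_of_surjective)
    (hmodD : nonempty_modularParametrizationData)
    (hGZK : rank_eq_analyticRank_of_analyticRank_le_one)
    (h310 : prop310_selmerCorank_mod_two_eq_lambdaInvariant)
    (hX : ClassX4Gord W p) (hp5 : 5 ≤ p) (he : semistabilityIndex W p = 2) (hsurj : Surj W p)
    (hr : W.analyticRank = 1) {Dh : PAdicHeightData W p} (hBcl : LeadingTermClauses W p Dh)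
    (hnd : ∀ {N : ℕ} [NeZero N] (f : CuspForm (Gamma0 N) 2), IsNewformOf W f →
      ∃ s : ℚ, ratPlusSymbol f s ≠ 0)
    (hcert : ∀ (V : WeierstrassCurve ℚ) [V.IsElliptic] [V.IsGloballyMinimal] (C : VariableChange ℚ),
      C • V.quadraticTwist ((-1 : ℚ) ^ (p / 2) * p) = W → IsOrdinaryAt V p →
      ∀ {N : ℕ} [NeZero N] (f : CuspForm (Gamma0 N) 2), IsNewformOf V f →
      ∀ ϖ : ℚ, (if Even (p / 2) then (ϖ : ℝ) * V.realPeriodRat = plusPeriod f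
          else (ϖ : ℝ) * V.imaginaryPeriodRat = minusPeriod f) →
        PowerSeries.coeff 1 (PowerSeries.C (ϖ : ℚ_[p]) *
            (if Even (p / 2) then padicLFunctionBranch f ((unitRoot V p : ℤ_[p]) : ℚ_[p]) (p / 2)
              else padicLFunctionMinusBranch f ((unitRoot V p : ℤ_[p]) : ℚ_[p]) (p / 2))) ≠ 0 ∧
        ‖PowerSeries.coeff 3 (PowerSeries.C (ϖ : ℚ_[p]) *
            (if Even (p / 2) then padicLFunctionBranch f ((unitRoot V p : ℤ_[p]) : ℚ_[p]) (p / 2)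
              else padicLFunctionMinusBranch f ((unitRoot V p : ℤ_[p]) : ℚ_[p]) (p / 2)))‖ = 1 ∧
        ∀ i < 3, ‖PowerSeries.coeff i (PowerSeries.C (ϖ : ℚ_[p]) *
            (if Even (p / 2) then padicLFunctionBranch f ((unitRoot V p : ℤ_[p]) : ℚ_[p]) (p / 2)
              else padicLFunctionMinusBranch f ((unitRoot V p : ℤ_[p]) : ℚ_[p]) (p / 2)))‖ < 1)
    {v : ℤ} (hv : v ≤ (padicRegulator Dh).valuation)
    (hb : (1 : ℤ) + 2 * padicValNat p W.torsionOrder < v + padicValNat p W.tamagawaProduct) :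
    TameBranchRatCharEqAt W p ∧
      ∀ (κ : ZpExtension ℚ p) (γ : Field.absoluteGaloisGroup ℚ),
        κ.IsCyclotomic → κ.IsTopGenerator γ → IsCyclotomicVariable p γ →
        ∀ (D : W.SelmerDualData κ γ) (fE : IwasawaAlgebra p), D.charIdeal = Ideal.span {fE} →
          mu fE = 0 ∧ lam fE = 3 := by
  have hp2 : p ≠ 2 := by omega
  obtain ⟨hmw, -⟩ := hGZK W (by rw [hr])
  have hr1 : W.mordellWeilRank = 1 := by rw [hmw, hr]
  obtain ⟨V, iV, iVm, C, hV, hC⟩ := hX.exists_goodOrd_pStar_twist_model W p he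
  haveI : NeZero (V.conductorNorm ℤ) := ⟨(V.conductorNorm_pos_holds).ne'⟩
  obtain ⟨Dm⟩ := hmodD V
  obtain ⟨ϖ, hϖ⟩ := exists_periodRatio_parity (p := p) V Dm
  have hj := padicValRat_j_nonneg_of_typeGOrd W p hX.typeGOrd
  have hsurjV : ∀ m : ℕ, V.HasSurjectiveModNGaloisRep (p ^ m : ℕ) :=
    X4RankZeroTwistOdd.forall_surj_pow_twist_of_surj W p hp5 V (pStar_ne_zero p) C hC hsurj
  have hord : IsOrdinaryAt V p :=
    isOrdinaryAt_of_goodOrd_or_mult_of_model_twist W V (pStar_ne_zero p) ⟨C, hC⟩ hj (Or.inl hV)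
  obtain ⟨h1, hn, hlt⟩ := hcert V C hC hord Dm.f Dm.isNewformOf ϖ hϖ
  have hϖ0 : ϖ ≠ 0 := by
    rintro rfl
    apply h1
    rw [Rat.cast_zero, map_zero, zero_mul, map_zero]
  have hB0 : (if Even (p / 2) then padicLFunctionBranch Dm.f ((unitRoot V p : ℤ_[p]) : ℚ_[p]) (p / 2)
      else padicLFunctionMinusBranch Dm.f ((unitRoot V p : ℤ_[p]) : ℚ_[p]) (p / 2)) ≠ 0 := by
    intro e; apply h1; rw [e, mul_zero, map_zero]
  have key : ∀ (κ : ZpExtension ℚ p) (γ : Field.absoluteGaloisGroup ℚ),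
      κ.IsCyclotomic → κ.IsTopGenerator γ → IsCyclotomicVariable p γ →
      ∀ (D : W.SelmerDualData κ γ) (fE : IwasawaAlgebra p), D.charIdeal = Ideal.span {fE} →
        D.IsTorsion ∧ mu fE = 0 ∧ lam fE = 3 ∧ ∃ (g₁ : IwasawaAlgebra p) (u : ℤ_[p]ˣ),
          D.charIdeal = Ideal.span {g₁} ∧ iwasawaToPowerSeries p g₁ =
            PowerSeries.C (((u : ℤ_[p]) : ℚ_[p]) * (ϖ : ℚ_[p])) *
              (if Even (p / 2) then padicLFunctionBranch Dm.f ((unitRoot V p : ℤ_[p]) : ℚ_[p]) (p / 2)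
                else padicLFunctionMinusBranch Dm.f ((unitRoot V p : ℤ_[p]) : ℚ_[p]) (p / 2)) := by
    intro κ γ hκ hγ hγ' D fE hchar
    haveI : Module.Finite (IwasawaAlgebra p) D.X :=
      SelmerDualData.module_finite_of_isCyclotomic (W := W) (κ := κ) hκ D hγ
    obtain ⟨hXt, g, hg, u, hι⟩ := isTorsion_and_exists_iota_eq_branch_of_katoComponent W p
      (Kato2004.charIdeal_dvd_padicLFunctionBranch_component_of_surjective_of_half hK) hj hp2 V
      ⟨C, hC⟩ (Or.inl hV) hsurjV hκ hγ hγ' Dm.isNewformOf D ϖ hϖ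
    have hn' := hn
    rw [← norm_coeff_C_unit_mul u] at hn'
    have hX1 : PowerSeries.coeff 1 (PowerSeries.C (((u : ℤ_[p]) : ℚ_[p]) * (ϖ : ℚ_[p])) *
        (if Even (p / 2) then padicLFunctionBranch Dm.f ((unitRoot V p : ℤ_[p]) : ℚ_[p]) (p / 2)
          else padicLFunctionMinusBranch Dm.f ((unitRoot V p : ℤ_[p]) : ℚ_[p]) (p / 2))) ≠ 0 := by
      rw [PowerSeries.coeff_C_mul, mul_assoc]
      rw [PowerSeries.coeff_C_mul] at h1
      exact mul_ne_zero (PadicInt.coe_ne_zero.mpr u.ne_zero) h1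
    obtain ⟨hμ, hlam, hspan⟩ := charIdeal_eq_span_of_iota_eq_of_firstUnit_three_rankOne h310 hp2 hr1
      hBcl hκ hγ hγ' D hXt hchar hg hι hn' (fun i hi ↦ by rw [norm_coeff_C_unit_mul u]; exact hlt i hi)
      hX1 hv hb
    exact ⟨hXt, hμ, hlam, g, u, hspan, hι⟩
  refine ⟨?_, fun κ γ hκ hγ hγ' D fE hchar ↦ ⟨(key κ γ hκ hγ hγ' D fE hchar).2.1,
    (key κ γ hκ hγ hγ' D fE hchar).2.2.1⟩⟩
  intro κ γ N _ f ε α B _ haddv _ hκ hγ hcv hf _ hα hB D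
  haveI : (Literature.NumberTheory.EllipticCurves.Module.charIdeal (IwasawaAlgebra p) D.X).IsPrincipal :=
    charIdeal_isPrincipal_holds p D.X
  obtain ⟨fE, hchar⟩ := Submodule.IsPrincipal.principal
    (Literature.NumberTheory.EllipticCurves.Module.charIdeal (IwasawaAlgebra p) D.X)
  obtain ⟨hXt, -, -, g₁, u, hspan, hι⟩ := key κ γ hκ hγ hcv D fE hchar
  exact ⟨hXt, exists_charIdeal_eq_span_and_iota_eq_of_generator hp2 V C hC haddv hV hf (hnd f hf) Dm
    hϖ0 hspan hι hB0 hα hB⟩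

end Headlines

end Summit.BirchSwinnertonDyer.Rank1Residual.Additive

end
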